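import Mathlib
import HarnessLib
import Summits.NavierStokesRegularity.FluidComputer.TriggeredTransferLedger

/-!
# A LINKED run of a one-shot triggered-transfer scheme: every level's solution, trigger, clock and
# hand-over state exposed, with the super-polynomially small seeds `ε_n = max (e^{-aU_n/ν}) (λ^{-n²})`

Cell `ns-blowup`, seat `ns-blowup-fc-prover-1` (D-0074 GROUP C «bridge support», door N1-FC).
Companion of `TriggeredTransfer.lean` (the N1-FC vocabulary `TriggerScheme`, `IsTrigger`, `Step`,
`Transfers`; ns-blowup-fc-route) and of `TriggeredTransferLedger.lean` (this seat, g0: the amplitude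
ledger and ONE run `exists_run`). LABEL: E–C bookkeeping. WHAT THIS IS NOT: not Navier–Stokes evidence
and not a construction — everything below is an implication from the OPEN predicate
`TriggerScheme.Transfers ν` (never asserted anywhere in the tree); no instance of any scheme is claimed.

This is the first file of the CASCADE-GLUING argument (the analysis half of door N1-FC, named in the
module docstring of `TriggeredTransfer.lean`): from `𝒮.Transfers ν` and Tao's forced unconditional
uniqueness one assembles an exact forced classical solution that blows up in finite time, i.e. a
`PalasekTowerClayBridge.BreakdownWitness ν`. The g0 run `exists_run` records only the PROPOSITION
`Step ν (U n) ε (w n)` at each level, which forgets that its hand-over state IS the next member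
`w (n+1)`; the gluing needs the data. Here:

* `TriggerScheme.Link ν U ε w` — the DATA of one triggered transfer (hand-over time `T`, margin `δ`,
  trigger `g`, solution `(u, p)`, target amplitude `U'`, target member `w'`, child centre `x₀`) with
  the clauses of `Step` as fields; `step_iff_nonempty_link : Step ν U ε w ↔ Nonempty (Link ν U ε w)`.
* THE LEVEL-`n` SEED `seedAt ν n U = max (exp (-(a U / ν))) ((λ ^ (n ^ 2))⁻¹)`: positive, `≤ 1`,
  ADMISSIBLE (`ν |log ε| ≤ a U`, because it is at least the canonical saturating seed) and at least
  `λ^{-n²}`, so `|log ε| ≤ n² log λ` (`abs_log_seedAt_le`) — the hand-over times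
  `T ≤ C_τ (1 + |log ε|)^q / U` are then poly-logarithmic in the LEVEL, whatever the amplitudes do,
  while `ε_n ≤ exp (-(a U_n/ν)) + λ^{-n²}` keeps the zoomed triggers summable in every `C^m`
  (used in the companion files).
* `TriggerScheme.Run ν` — a LINKED run: sequences `U n`, `w n` and links `link n : Link ν (U n)
  (seedAt ν n (U n)) (w n)` with `U (n+1) = (link n).U'`, `w (n+1) = (link n).w'` (the hand-over state
  of level `n` is the source state of level `n+1`); `nonempty_run : 0 < ν → Transfers ν →
  Nonempty (Run ν)` by dependent choice from the scheme's `seed`.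
* Bookkeeping along a run: thresholds, the geometric climb `U 0 · growthⁿ ≤ U n → ∞`
  (`Re_{k+1} ≥ (ηλ)^{1/2} Re_k`, the FC-AUDIT floor in action), the Clay clauses and speed floors of
  the members, and the level clock bound `(link n).T ≤ C_τ (1 + n² log λ)^q / U n`.

References: T. Tao, J. Amer. Math. Soc. 29 (2016) §1.3 (machine paradigm: gadgets, clock, trigger);
C. L. Fefferman, Clay problem description (C). 0 sorry; axioms ⊆ {propext, Classical.choice, Quot.sound}.
-/

noncomputable section

namespace Summit.NavierStokesRegularity.FluidComputer.TriggeredTransfer.TriggerScheme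

open Set Filter Function MeasureTheory
open scoped Topology ENNReal ContDiff
open Literature.Analysis.FluidPDE
open Literature.Analysis.FluidPDE.FluidComputer (E3 Vel)

variable (𝒮 : TriggerScheme)

/-! ## One triggered transfer with its data exposed -/

/-- **The data of one triggered transfer** at viscosity `ν` from the unit-scale level state `w` of
amplitude `U` with trigger amplitude `ε`: exactly the witnesses of the existential statement
`TriggerScheme.Step ν U ε w`, as fields — hand-over time `T`, margin `δ` (`0 < δ`, `2δ < T`,
`T ≤ C_τ (1 + |log ε|)^q / U`), an admissible trigger `g` (zero for `t ≤ δ`, for `t ≥ T` and outside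
the nest ball), an exact classical solution `(u, p)` of the system forced by `g` on `[0, T + δ]` with
`u 0 = w` and finite energy, and the hand-over `u T = (x ↦ λ • w' (λ • (x - x₀)))` to a member `w'` at
amplitude `U' ≥ growth · U`, `‖x₀‖ ≤ D`. A TYPE of witnesses; inhabited iff `Step` holds
(`step_iff_nonempty_link`). [cite: Tao2016AveragedNS, §1.3] -/
structure Link (ν U ε : ℝ) (w : Vel) where
  /-- hand-over time -/
  T : ℝ
  /-- margin: the piece starts and ends with an unforced layer of length `δ` -/
  δ : ℝ
  /-- the trigger -/
  g : ℝ → Vel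
  /-- velocity of the piece -/
  u : ℝ → Vel
  /-- pressure of the piece -/
  p : ℝ → E3 → ℝ
  /-- amplitude of the hand-over state -/
  U' : ℝ
  /-- the member handed over to (unit scale) -/
  w' : Vel
  /-- centre of the child (unit scale of the parent) -/
  x₀ : E3
  δ_pos : 0 < δ
  two_δ_lt : 2 * δ < T
  T_le : T ≤ 𝒮.Cτ * (1 + |Real.log ε|) ^ 𝒮.q / U
  trigger : 𝒮.IsTrigger ε δ T g
  classical : IsClassicalNSSolutionOn (Icc 0 (T + δ)) ν g u p
  initial : u 0 = w
  energy : ∃ C : ℝ≥0∞, C < ⊤ ∧ ∀ t ∈ Icc 0 (T + δ), ∫⁻ x, ‖u t x‖ₑ ^ 2 ≤ C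
  growth_le : 𝒮.growth * U ≤ U'
  mem : w' ∈ 𝒮.F U'
  norm_x₀_le : ‖x₀‖ ≤ 𝒮.D
  handover : u T = fun x => 𝒮.lam • w' (𝒮.lam • (x - x₀))

/-- `Step ν U ε w` holds iff the type of its witnesses `Link ν U ε w` is inhabited (unpacking /
repacking the existential). [folklore] -/
theorem step_iff_nonempty_link {ν U ε : ℝ} {w : Vel} :
    𝒮.Step ν U ε w ↔ Nonempty (𝒮.Link ν U ε w) := by
  constructor
  · rintro ⟨T, δ, g, u, p, hδ, h2δ, hT, htrig, hcl, hu0, hE, U', w', x₀, hgrow, hw', hx₀, hhand⟩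
    exact ⟨⟨T, δ, g, u, p, U', w', x₀, hδ, h2δ, hT, htrig, hcl, hu0, hE, hgrow, hw', hx₀, hhand⟩⟩
  · rintro ⟨L⟩
    exact ⟨L.T, L.δ, L.g, L.u, L.p, L.δ_pos, L.two_δ_lt, L.T_le, L.trigger, L.classical, L.initial,
      L.energy, L.U', L.w', L.x₀, L.growth_le, L.mem, L.norm_x₀_le, L.handover⟩

namespace Link

variable {𝒮} {ν U ε : ℝ} {w : Vel} (L : 𝒮.Link ν U ε w)

/-- The margin is shorter than the hand-over time: `δ < T`. [folklore] -/
theorem δ_lt_T : L.δ < L.T := by linarith [L.δ_pos, L.two_δ_lt]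

/-- The hand-over time is positive. [folklore] -/
theorem T_pos : 0 < L.T := L.δ_pos.trans L.δ_lt_T

/-- The piece lives on a non-degenerate slab: `0 < T + δ`. [folklore] -/
theorem T_add_δ_pos : 0 < L.T + L.δ := add_pos L.T_pos L.δ_pos

/-- The hand-over time lies in the slab `[0, T + δ]`. [folklore] -/
theorem T_mem_Icc : L.T ∈ Icc 0 (L.T + L.δ) := ⟨L.T_pos.le, by linarith [L.δ_pos]⟩

/-- Time `0` lies in the slab `[0, T + δ]`. [folklore] -/
theorem zero_mem_Icc : (0 : ℝ) ∈ Icc 0 (L.T + L.δ) := ⟨le_rfl, L.T_add_δ_pos.le⟩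

/-- If the source amplitude is at least the threshold then so is the target amplitude
(`U' ≥ growth · U ≥ U ≥ U⋆`). [folklore] -/
theorem UStar_le_U' (hU : 𝒮.UStar ≤ U) : 𝒮.UStar ≤ L.U' :=
  hU.trans ((le_mul_of_one_le_left (𝒮.UStar_pos.le.trans hU) 𝒮.one_le_growth).trans L.growth_le)

/-- The trigger is switched off at and after the hand-over time. [folklore] -/
theorem g_eq_zero_of_T_le {t : ℝ} (ht : L.T ≤ t) : L.g t = 0 := L.trigger.off_late t ht

/-- The trigger is switched off during the initial layer `t ≤ δ`. [folklore] -/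
theorem g_eq_zero_of_le_δ {t : ℝ} (ht : t ≤ L.δ) : L.g t = 0 := L.trigger.off_early t ht

end Link

/-! ## The level-`n` seed -/

/-- **The level-`n` seed** at viscosity `ν` and amplitude `U`:
`ε = max (exp (-(a U / ν))) (λ^{-n²})` — the canonical admissible seed, but never smaller than
`λ^{-n²}` (so that the hand-over time, poly-logarithmic in `1/ε`, is polynomial in the level). [folklore] -/
def seedAt (ν : ℝ) (n : ℕ) (U : ℝ) : ℝ :=
  max (Real.exp (-(𝒮.a * U / ν))) ((𝒮.lam ^ (n ^ 2))⁻¹)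

/-- `λ^{n²} ≥ 1`. [folklore] -/
theorem one_le_lam_pow (k : ℕ) : 1 ≤ 𝒮.lam ^ k := one_le_pow₀ 𝒮.one_lt_lam.le

/-- `λ^{k} > 0`. [folklore] -/
theorem lam_pow_pos (k : ℕ) : 0 < 𝒮.lam ^ k := pow_pos 𝒮.lam_pos k

/-- The seed dominates the canonical seed. [folklore] -/
theorem exp_le_seedAt (ν : ℝ) (n : ℕ) (U : ℝ) : Real.exp (-(𝒮.a * U / ν)) ≤ 𝒮.seedAt ν n U :=
  le_max_left _ _

/-- The seed dominates `λ^{-n²}`. [folklore] -/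
theorem pow_inv_le_seedAt (ν : ℝ) (n : ℕ) (U : ℝ) : (𝒮.lam ^ (n ^ 2))⁻¹ ≤ 𝒮.seedAt ν n U :=
  le_max_right _ _

/-- The seed is positive. [folklore] -/
theorem seedAt_pos (ν : ℝ) (n : ℕ) (U : ℝ) : 0 < 𝒮.seedAt ν n U :=
  lt_of_lt_of_le (Real.exp_pos _) (𝒮.exp_le_seedAt ν n U)

/-- The seed is at most `1` (`ν > 0`, `U ≥ 0`). [folklore] -/
theorem seedAt_le_one {ν : ℝ} (hν : 0 < ν) (n : ℕ) {U : ℝ} (hU : 0 ≤ U) : 𝒮.seedAt ν n U ≤ 1 :=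
  max_le (𝒮.seed_le_one hν hU) (inv_le_one_of_one_le₀ (𝒮.one_le_lam_pow _))

/-- The seed is bounded by the SUM of its two candidates (used for the summability of the zoomed
triggers' `C^m` norms). [folklore] -/
theorem seedAt_le_add (ν : ℝ) (n : ℕ) (U : ℝ) :
    𝒮.seedAt ν n U ≤ Real.exp (-(𝒮.a * U / ν)) + (𝒮.lam ^ (n ^ 2))⁻¹ :=
  max_le_add_of_nonneg (Real.exp_pos _).le (inv_nonneg.2 (𝒮.lam_pow_pos _).le)

/-- For a seed `ε ∈ (0, 1]`: `|log ε| = - log ε`. [folklore] -/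
theorem abs_log_eq_neg_log {ε : ℝ} (hε : 0 < ε) (hε1 : ε ≤ 1) : |Real.log ε| = -Real.log ε :=
  abs_of_nonpos (Real.log_nonpos hε.le hε1)

/-- **Admissibility of the level seed**: `ν |log ε| ≤ a U` (`ν > 0`, `U ≥ 0`) — because
`ε ≥ exp (-(aU/ν))`, the seed that saturates the e-fold budget. [folklore] -/
theorem seedAt_admissible {ν : ℝ} (hν : 0 < ν) (n : ℕ) {U : ℝ} (hU : 0 ≤ U) :
    ν * |Real.log (𝒮.seedAt ν n U)| ≤ 𝒮.a * U := by
  have hpos := 𝒮.seedAt_pos ν n U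
  rw [abs_log_eq_neg_log hpos (𝒮.seedAt_le_one hν n hU)]
  have hlog : -(𝒮.a * U / ν) ≤ Real.log (𝒮.seedAt ν n U) := by
    have := Real.log_le_log (Real.exp_pos _) (𝒮.exp_le_seedAt ν n U)
    rwa [Real.log_exp] at this
  calc ν * -Real.log (𝒮.seedAt ν n U) ≤ ν * (𝒮.a * U / ν) :=
        mul_le_mul_of_nonneg_left (by linarith) hν.le
    _ = 𝒮.a * U := mul_div_cancel₀ _ hν.ne'

/-- **The seed is only polynomially small in the level**: `|log ε| ≤ n² log λ` (`ν > 0`, `U ≥ 0`),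
because `ε ≥ λ^{-n²}`. [folklore] -/
theorem abs_log_seedAt_le {ν : ℝ} (hν : 0 < ν) (n : ℕ) {U : ℝ} (hU : 0 ≤ U) :
    |Real.log (𝒮.seedAt ν n U)| ≤ (n : ℝ) ^ 2 * Real.log 𝒮.lam := by
  have hpos := 𝒮.seedAt_pos ν n U
  rw [abs_log_eq_neg_log hpos (𝒮.seedAt_le_one hν n hU)]
  have hlog : Real.log ((𝒮.lam ^ (n ^ 2))⁻¹) ≤ Real.log (𝒮.seedAt ν n U) :=
    Real.log_le_log (inv_pos.2 (𝒮.lam_pow_pos _)) (𝒮.pow_inv_le_seedAt ν n U)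
  rw [Real.log_inv, Real.log_pow] at hlog
  push_cast at hlog
  linarith

/-- The clock law at the level seed: `C_τ (1 + |log ε|)^q / U ≤ C_τ (1 + n² log λ)^q / U`
(`ν > 0`, `U > 0`). [folklore] -/
theorem clock_le_of_seedAt {ν : ℝ} (hν : 0 < ν) (n : ℕ) {U : ℝ} (hU : 0 < U) :
    𝒮.Cτ * (1 + |Real.log (𝒮.seedAt ν n U)|) ^ 𝒮.q / U ≤
      𝒮.Cτ * (1 + (n : ℝ) ^ 2 * Real.log 𝒮.lam) ^ 𝒮.q / U := by
  have h1 : 1 + |Real.log (𝒮.seedAt ν n U)| ≤ 1 + (n : ℝ) ^ 2 * Real.log 𝒮.lam := by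
    linarith [𝒮.abs_log_seedAt_le hν n hU.le]
  have h0 : 0 ≤ 1 + |Real.log (𝒮.seedAt ν n U)| := by positivity
  exact div_le_div_of_nonneg_right
    (mul_le_mul_of_nonneg_left (pow_le_pow_left₀ h0 h1 _) 𝒮.Cτ_pos.le) hU.le

/-! ## Linked runs -/

/-- **A linked run of the scheme at viscosity `ν`**: level amplitudes `U n`, level states `w n`, and
for every level the DATA `link n` of one triggered transfer fired from `w n` with the level seed
`seedAt ν n (U n)`, LINKED: the hand-over amplitude and member of level `n` are the source amplitude
and state of level `n + 1` (`U_succ`, `w_succ`); the run starts at or above threshold from a member.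
A TYPE; inhabited under `Transfers ν` (`nonempty_run`), never otherwise claimed. [cite: Tao2016AveragedNS, §1.3] -/
structure Run (ν : ℝ) where
  /-- level amplitudes (level Reynolds numbers at unit viscosity) -/
  U : ℕ → ℝ
  /-- level states (unit scale) -/
  w : ℕ → Vel
  /-- the triggered transfer of level `n`, with its data -/
  link : ∀ n, 𝒮.Link ν (U n) (𝒮.seedAt ν n (U n)) (w n)
  UStar_le_zero : 𝒮.UStar ≤ U 0
  mem_zero : w 0 ∈ 𝒮.F (U 0)
  U_succ : ∀ n, U (n + 1) = (link n).U'
  w_succ : ∀ n, w (n + 1) = (link n).w'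

/-- **Dependent choice: a transferring scheme has a linked run** (`ν > 0`). From the scheme's
inhabited ignition level (`seed`), fire at every level the transfer that `Transfers ν` provides for
the (admissible) level seed, and continue from its hand-over member. [cite: Tao2016AveragedNS, §1.3] -/
theorem nonempty_run {ν : ℝ} (hν : 0 < ν) (hT : 𝒮.Transfers ν) : Nonempty (𝒮.Run ν) := by
  classical
  -- admissible states
  let X := {q : ℝ × Vel // 𝒮.UStar ≤ q.1 ∧ q.2 ∈ 𝒮.F q.1}
  have key : ∀ (n : ℕ) (q : X), Nonempty (𝒮.Link ν q.1.1 (𝒮.seedAt ν n q.1.1) q.1.2) := by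
    intro n q
    have hU0 : 0 ≤ q.1.1 := 𝒮.UStar_pos.le.trans q.2.1
    exact 𝒮.step_iff_nonempty_link.1 (hT q.1.1 q.2.1 q.1.2 q.2.2 _ (𝒮.seedAt_pos ν n _)
      (𝒮.seedAt_le_one hν n hU0) (𝒮.seedAt_admissible hν n hU0))
  let lk : ∀ (n : ℕ) (q : X), 𝒮.Link ν q.1.1 (𝒮.seedAt ν n q.1.1) q.1.2 := fun n q =>
    Classical.choice (key n q)
  -- the successor state: the hand-over amplitude and member
  let nx : ℕ → X → X := fun n q =>
    ⟨((lk n q).U', (lk n q).w'), (lk n q).UStar_le_U' q.2.1, (lk n q).mem⟩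
  obtain ⟨U₀, hU₀, w₀, hw₀⟩ := 𝒮.seed
  let q₀ : X := ⟨(U₀, w₀), hU₀, hw₀⟩
  let st : ℕ → X := fun n => Nat.rec q₀ (fun k q => nx k q) n
  have hst : ∀ n, st (n + 1) = nx n (st n) := fun n => rfl
  exact ⟨{ U := fun n => (st n).1.1
           w := fun n => (st n).1.2
           link := fun n => lk n (st n)
           UStar_le_zero := hU₀
           mem_zero := hw₀
           U_succ := fun n => by rw [hst n]
           w_succ := fun n => by rw [hst n] }⟩

namespace Run

variable {𝒮} {ν : ℝ} (ρ : 𝒮.Run ν)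

/-- The amplitudes climb by the growth factor: `growth · U n ≤ U (n+1)` (`Re_{k+1} ≥ (ηλ)^{1/2} Re_k`). [folklore] -/
theorem growth_mul_le (n : ℕ) : 𝒮.growth * ρ.U n ≤ ρ.U (n + 1) := by
  rw [ρ.U_succ n]
  exact (ρ.link n).growth_le

/-- Every amplitude of a run is at or above the threshold. [folklore] -/
theorem UStar_le (n : ℕ) : 𝒮.UStar ≤ ρ.U n :=
  𝒮.UStar_le_of_chain ρ.growth_mul_le ρ.UStar_le_zero n

/-- Every amplitude of a run is positive. [folklore] -/
theorem U_pos (n : ℕ) : 0 < ρ.U n := 𝒮.UStar_pos.trans_le (ρ.UStar_le n)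

/-- Every state of a run is a member of the family at its amplitude. [folklore] -/
theorem mem (n : ℕ) : ρ.w n ∈ 𝒮.F (ρ.U n) := by
  cases n with
  | zero => exact ρ.mem_zero
  | succ n =>
    rw [ρ.w_succ n, ρ.U_succ n]
    exact (ρ.link n).mem

/-- **Geometric climb**: `U 0 · growthⁿ ≤ U n`. [folklore] -/
theorem mul_pow_le (n : ℕ) : ρ.U 0 * 𝒮.growth ^ n ≤ ρ.U n :=
  𝒮.mul_pow_le_of_chain ρ.growth_mul_le n

/-- The amplitudes are non-decreasing along a run. [folklore] -/
theorem U_le_succ (n : ℕ) : ρ.U n ≤ ρ.U (n + 1) :=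
  𝒮.le_succ_of_chain ρ.growth_mul_le (ρ.U_pos n).le

/-- The amplitudes are monotone along a run. [folklore] -/
theorem monotone_U : Monotone ρ.U := monotone_nat_of_le_succ ρ.U_le_succ

/-- **The level Reynolds numbers of a run tend to infinity.** [folklore] -/
theorem tendsto_U : Tendsto ρ.U atTop atTop :=
  𝒮.tendsto_atTop_of_chain ρ.growth_mul_le (ρ.U_pos 0)

/-- The states of a run are smooth (Clay datum clause (A)(4)). [folklore] -/
theorem contDiff_w (n : ℕ) : ContDiff ℝ ∞ (ρ.w n) :=
  (𝒮.clay (ρ.U n) (ρ.UStar_le n) (ρ.w n) (ρ.mem n)).1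

/-- The states of a run are divergence free. [folklore] -/
theorem isDivFree_w (n : ℕ) : NSWave0.IsDivFree (ρ.w n) :=
  (𝒮.clay (ρ.U n) (ρ.UStar_le n) (ρ.w n) (ρ.mem n)).2.1

/-- The states of a run decay rapidly with all derivatives (Clay (4)). [folklore] -/
theorem hasRapidSpatialDecay_w (n : ℕ) : HasRapidSpatialDecay (ρ.w n) :=
  (𝒮.clay (ρ.U n) (ρ.UStar_le n) (ρ.w n) (ρ.mem n)).2.2

/-- **Speed floor of the level states**: `‖w n x‖ ≥ c · U n` somewhere in the closed nest ball. [folklore] -/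
theorem exists_floor (n : ℕ) : ∃ x : E3, ‖x‖ ≤ 𝒮.R ∧ 𝒮.c * ρ.U n ≤ ‖ρ.w n x‖ :=
  𝒮.floor (ρ.U n) (ρ.UStar_le n) (ρ.w n) (ρ.mem n)

/-- The piece of level `n` starts at the level state: `(link n).u 0 = w n`. [folklore] -/
theorem u_zero (n : ℕ) : (ρ.link n).u 0 = ρ.w n := (ρ.link n).initial

/-- **The hand-over identity along a run**: the piece of level `n` at its hand-over time is the
`λ`-zoom of the NEXT state about the child centre,
`(link n).u T_n = (x ↦ λ • w (n+1) (λ • (x - x₀)))`. [folklore] -/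
theorem handover (n : ℕ) :
    (ρ.link n).u (ρ.link n).T = fun x => 𝒮.lam • ρ.w (n + 1) (𝒮.lam • (x - (ρ.link n).x₀)) := by
  rw [ρ.w_succ n]
  exact (ρ.link n).handover

/-- **The level clock is polynomial in the level**: `T_n ≤ C_τ (1 + n² log λ)^q / U n` (`ν > 0`). [folklore] -/
theorem T_le (hν : 0 < ν) (n : ℕ) :
    (ρ.link n).T ≤ 𝒮.Cτ * (1 + (n : ℝ) ^ 2 * Real.log 𝒮.lam) ^ 𝒮.q / ρ.U n :=
  (ρ.link n).T_le.trans (𝒮.clock_le_of_seedAt hν n (ρ.U_pos n))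

/-- The level clock against the geometric climb: `T_n ≤ C_τ (1 + n² log λ)^q / (U 0 · growthⁿ)`. [folklore] -/
theorem T_le_geometric (hν : 0 < ν) (n : ℕ) :
    (ρ.link n).T ≤ 𝒮.Cτ * (1 + (n : ℝ) ^ 2 * Real.log 𝒮.lam) ^ 𝒮.q / (ρ.U 0 * 𝒮.growth ^ n) := by
  refine (ρ.T_le hν n).trans ?_
  have hnum : 0 ≤ 𝒮.Cτ * (1 + (n : ℝ) ^ 2 * Real.log 𝒮.lam) ^ 𝒮.q :=
    mul_nonneg 𝒮.Cτ_pos.le (pow_nonneg (by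
      have := Real.log_nonneg 𝒮.one_lt_lam.le
      positivity) _)
  exact div_le_div_of_nonneg_left hnum (mul_pos (ρ.U_pos 0) (pow_pos 𝒮.growth_pos n))
    (ρ.mul_pow_le n)

/-- The level seed of a run lies in `(0, 1]` and is at most `exp (-(a U_n/ν)) + λ^{-n²}`. [folklore] -/
theorem seedAt_le_one (hν : 0 < ν) (n : ℕ) : 𝒮.seedAt ν n (ρ.U n) ≤ 1 :=
  𝒮.seedAt_le_one hν n (ρ.U_pos n).le

/-- The canonical part of the level seed against the geometric climb:
`exp (-(a U_n / ν)) ≤ exp (-(a U_0 growthⁿ / ν))` (`ν > 0`). [folklore] -/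
theorem exp_seed_le_geometric (hν : 0 < ν) (n : ℕ) :
    Real.exp (-(𝒮.a * ρ.U n / ν)) ≤ Real.exp (-(𝒮.a * (ρ.U 0 * 𝒮.growth ^ n) / ν)) := by
  rw [Real.exp_le_exp, neg_le_neg_iff]
  exact div_le_div_of_nonneg_right (mul_le_mul_of_nonneg_left (ρ.mul_pow_le n) 𝒮.a_pos.le) hν.le

end Run

end Summit.NavierStokesRegularity.FluidComputer.TriggeredTransfer.TriggerScheme

end
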